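import Mathlib
import Literature.Analysis.SpecialFunctions.ZhouTripleEllipticIntegralWick

/-!
# Stub `stub_tiltedRankOneMoment` of line `crossing-split-integrability`
(crux `Summit.QuantumFields.QCD.Theses.PauliWegnerSea.PhaseQuenchedFlavourDecay`, item stmt-QuantumFields-9151)

**The rank-one / single-site analogue of the tilted minor-moment core (Mathlib only).**
For a complex square matrix `A`, a site `x`, a real single-site coupling `v` uniform on `[-R, R]`,
`N ≥ 1` degenerate flavours and `0 ≤ ε < N` there is `K = K(N, ε, R) ≥ 0`, independent of `A` and of
its size, with
`∫_{-R}^{R} |det(A + v E_xx)|^N |(A + v E_xx)⁻¹_xx|^{1+ε} dv ≤ K ∫_{-R}^{R} |det(A + v E_xx)|^N dv`.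

Proof.
* Algebra: `A + v E_xx = A.updateRow x (A x + v e_x)`, so `det(A + v E_xx) = det A + v c` with
  `c := det (A.updateRow x e_x)` (`Matrix.det_updateRow_add/smul`), and
  `adj(A + v E_xx)_xx = c` (`Matrix.adjugate_apply`, `Matrix.updateRow_idem`), whence
  `(A + v E_xx)⁻¹_xx = (det A + v c)⁻¹ c` (`Matrix.inv_def`, junk inverse `0⁻¹ = 0`).
* If `c = 0` the left integrand vanishes.  If `c ≠ 0`, `det A + v c = c (v - w)` and the left
  integrand is `≤ ‖c‖^N ‖v - w‖^p`, `p := N - 1 - ε ∈ (-1, N)`, the right one is `‖c‖^N ‖v - w‖^N`.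
* One-variable lemma, uniformly in `w ∈ ℂ`: `∫_{-R}^{R} ‖v - w‖^N ≥ (R/2)^{N+1}` (on a quarter of
  the interval `‖v - w‖ ≥ |v - Re w| ≥ R/2`); if `‖w‖ > 2R` then `‖v - w‖ ≥ R` on `[-R, R]` and
  `‖v - w‖^p ≤ R^{p-N} ‖v - w‖^N` pointwise; if `‖w‖ ≤ 2R` then a.e.
  `‖v - w‖^p ≤ (3R)^p + |v - Re w|^p` and `∫_{-R}^{R} |v - Re w|^p ≤ ∫_{-3R}^{3R} |u|^p < ∞`
  (tree lemmas `intervalIntegrable_abs_rpow`, `intervalIntegrable_abs_sub_rpow` of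
  `Literature.Analysis.SpecialFunctions`, translation, `intervalIntegral.integral_mono_interval`).
  Hence `K := R^{p-N} + (2R (3R)^p + ∫_{-3R}^{3R} |u|^p) / (R/2)^{N+1}` works.
-/

noncomputable section

namespace Summit.QuantumFields.QCD.Cruxes.PhaseQuenchedFlavourDecay.CrossingSplitIntegrability

open scoped BigOperators
open MeasureTheory
open Literature.Analysis.SpecialFunctions (intervalIntegrable_abs_rpow
  intervalIntegrable_abs_sub_rpow)

/-! ### Matrix algebra of the rank-one diagonal perturbation -/

/-- Adding `z • E_xx` to `A` replaces row `x` of `A` by `A x + z • e_x`. -/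
theorem tiltedRankOne_add_smul_single_eq_updateRow {n : ℕ} (A : Matrix (Fin n) (Fin n) ℂ)
    (x : Fin n) (z : ℂ) :
    A + z • Matrix.single x x (1 : ℂ) = A.updateRow x (A x + z • Pi.single x 1) := by
  ext i j
  rw [Matrix.add_apply, Matrix.smul_apply, Matrix.single_apply, Matrix.updateRow_apply]
  by_cases hi : i = x
  · by_cases hj : j = x
    · simp [hi, hj]
    · simp [hi, hj, Ne.symm hj]
  · simp [hi, Ne.symm hi]

/-- `det (A + z • E_xx) = det A + z * det (A.updateRow x e_x)` (the determinant is affine in `z`). -/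
theorem tiltedRankOne_det_add_smul_single {n : ℕ} (A : Matrix (Fin n) (Fin n) ℂ) (x : Fin n)
    (z : ℂ) :
    (A + z • Matrix.single x x (1 : ℂ)).det = A.det + z * (A.updateRow x (Pi.single x 1)).det := by
  rw [tiltedRankOne_add_smul_single_eq_updateRow, Matrix.det_updateRow_add, Matrix.updateRow_eq_self,
    Matrix.det_updateRow_smul]

/-- The diagonal entry of the (junk-valued) inverse: `(A + z • E_xx)⁻¹ x x = (det A + z c)⁻¹ * c`
with `c = det (A.updateRow x e_x)` the `(x, x)` cofactor, which does not depend on `z`. -/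
theorem tiltedRankOne_inv_add_smul_single_apply {n : ℕ} (A : Matrix (Fin n) (Fin n) ℂ) (x : Fin n)
    (z : ℂ) :
    (A + z • Matrix.single x x (1 : ℂ))⁻¹ x x =
      (A.det + z * (A.updateRow x (Pi.single x 1)).det)⁻¹ * (A.updateRow x (Pi.single x 1)).det := by
  rw [Matrix.inv_def, Matrix.smul_apply, smul_eq_mul, Matrix.adjugate_apply,
    tiltedRankOne_det_add_smul_single, tiltedRankOne_add_smul_single_eq_updateRow,
    Matrix.updateRow_idem, Ring.inverse_eq_inv]

/-! ### One-variable real analysis -/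

/-- Uniform bound on the translated singular integral: for `|a| ≤ 2R`,
`∫_{-R}^{R} |v - a|^p dv ≤ ∫_{-3R}^{3R} |u|^p du`. -/
theorem tiltedRankOne_integral_abs_sub_rpow_le {p R a : ℝ} (hp : -1 < p) (hR : 0 < R)
    (ha : |a| ≤ 2 * R) :
    ∫ v in (-R)..R, |v - a| ^ p ≤ ∫ u in (-(3 * R))..(3 * R), |u| ^ p := by
  have h : ∫ v in (-R)..R, |v - a| ^ p = ∫ u in (-R - a)..(R - a), |u| ^ p :=
    intervalIntegral.integral_comp_sub_right (fun u : ℝ => |u| ^ p) a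
  rw [h]
  obtain ⟨ha1, ha2⟩ := abs_le.1 ha
  exact intervalIntegral.integral_mono_interval (by linarith) (by linarith) (by linarith)
    (ae_of_all _ fun u => (Real.rpow_nonneg (abs_nonneg u) p : (0 : ℝ) ≤ |u| ^ p))
    (intervalIntegrable_abs_rpow hp _ _)

/-- Uniform lower bound `(R/2)^(N+1) ≤ ∫_{-R}^{R} ‖v - w‖^N dv` for every `w ∈ ℂ`. -/
theorem tiltedRankOne_lower_bound {R : ℝ} (hR : 0 < R) (N : ℕ) (w : ℂ) :
    (R / 2) ^ (N + 1) ≤ ∫ v in (-R)..R, ‖(v : ℂ) - w‖ ^ N := by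
  have hcont : Continuous fun v : ℝ => ‖(v : ℂ) - w‖ ^ N :=
    ((Complex.continuous_ofReal.sub continuous_const).norm).pow N
  have hint : ∀ a b : ℝ, IntervalIntegrable (fun v : ℝ => ‖(v : ℂ) - w‖ ^ N) volume a b :=
    fun a b => hcont.intervalIntegrable a b
  have hnn : ∀ a b : ℝ, a ≤ b → 0 ≤ ∫ v in a..b, ‖(v : ℂ) - w‖ ^ N :=
    fun a b hab => intervalIntegral.integral_nonneg hab fun v _ => by positivity
  have hre : ∀ v : ℝ, |v - w.re| ≤ ‖(v : ℂ) - w‖ := fun v => by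
    simpa using Complex.abs_re_le_norm ((v : ℂ) - w)
  rcases le_total 0 w.re with hw | hw
  · have h1 : ∫ _ in (-R)..(-(R / 2)), ((R / 2) ^ N : ℝ) ≤
        ∫ v in (-R)..(-(R / 2)), ‖(v : ℂ) - w‖ ^ N := by
      refine intervalIntegral.integral_mono_on (by linarith) intervalIntegrable_const (hint _ _)
        fun v hv => ?_
      refine pow_le_pow_left₀ (by positivity) ?_ N
      calc R / 2 ≤ |v - w.re| := by
            rw [abs_of_nonpos (by linarith [hv.2])]; linarith [hv.2]
        _ ≤ _ := hre v
    rw [intervalIntegral.integral_const, smul_eq_mul] at h1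
    have h2 := intervalIntegral.integral_add_adjacent_intervals (hint (-R) (-(R / 2)))
      (hint (-(R / 2)) R)
    have h3 := hnn (-(R / 2)) R (by linarith)
    calc (R / 2) ^ (N + 1) = (-(R / 2) - -R) * (R / 2) ^ N := by ring
      _ ≤ _ := h1
      _ ≤ _ := by linarith
  · have h1 : ∫ _ in (R / 2)..R, ((R / 2) ^ N : ℝ) ≤ ∫ v in (R / 2)..R, ‖(v : ℂ) - w‖ ^ N := by
      refine intervalIntegral.integral_mono_on (by linarith) intervalIntegrable_const (hint _ _)
        fun v hv => ?_
      refine pow_le_pow_left₀ (by positivity) ?_ N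
      calc R / 2 ≤ |v - w.re| := by
            rw [abs_of_nonneg (by linarith [hv.1])]; linarith [hv.1]
        _ ≤ _ := hre v
    rw [intervalIntegral.integral_const, smul_eq_mul] at h1
    have h2 := intervalIntegral.integral_add_adjacent_intervals (hint (-R) (R / 2)) (hint (R / 2) R)
    have h3 := hnn (-R) (R / 2) (by linarith)
    calc (R / 2) ^ (N + 1) = (R - R / 2) * (R / 2) ^ N := by ring
      _ ≤ _ := h1
      _ ≤ _ := by linarith

/-- **The one-variable lemma** (with a built-in non-integrable-safe comparison).  For `0 ≤ ε < N`,
`R > 0` and `p := N - 1 - ε` there is `K ≥ 0` such that for every `w ∈ ℂ`, every scale `s ≥ 0` and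
every nonnegative `g ≤ s ‖v - w‖^p` one has `∫_{-R}^{R} g ≤ K ∫_{-R}^{R} s ‖v - w‖^N`. -/
theorem tiltedRankOne_oneVariable (N : ℕ) (ε R : ℝ) (hε : 0 ≤ ε) (hεN : ε < N) (hR : 0 < R) :
    ∃ K : ℝ, 0 ≤ K ∧ ∀ (w : ℂ) (s : ℝ) (g : ℝ → ℝ), 0 ≤ s → (∀ v, 0 ≤ g v) →
      (∀ v, g v ≤ s * ‖(v : ℂ) - w‖ ^ ((N : ℝ) - 1 - ε)) →
      ∫ v in (-R)..R, g v ≤ K * ∫ v in (-R)..R, s * ‖(v : ℂ) - w‖ ^ N := by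
  set p : ℝ := (N : ℝ) - 1 - ε with hp
  have hp1 : -1 < p := by rw [hp]; linarith
  have hpN : p - N ≤ 0 := by rw [hp]; linarith
  have hR3 : 0 < 3 * R := by positivity
  set I : ℝ := ∫ u in (-(3 * R))..(3 * R), |u| ^ p with hI
  have hI0 : 0 ≤ I :=
    intervalIntegral.integral_nonneg (by linarith) fun u _ => Real.rpow_nonneg (abs_nonneg u) p
  set C : ℝ := 2 * R * (3 * R) ^ p + I with hC
  have hC0 : 0 ≤ C := add_nonneg (by positivity) hI0
  set cR : ℝ := (R / 2) ^ (N + 1) with hcR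
  have hcR0 : 0 < cR := by positivity
  have hK0 : 0 ≤ R ^ (p - N) + C / cR := add_nonneg (Real.rpow_nonneg hR.le _) (div_nonneg hC0 hcR0.le)
  refine ⟨R ^ (p - N) + C / cR, hK0, ?_⟩
  intro w s g hs hg0 hg
  have hRle : -R ≤ R := by linarith
  have hlow : cR ≤ ∫ v in (-R)..R, ‖(v : ℂ) - w‖ ^ N := tiltedRankOne_lower_bound hR N w
  have hTnn : 0 ≤ ∫ v in (-R)..R, ‖(v : ℂ) - w‖ ^ N := hcR0.le.trans hlow
  have hnormv : ∀ v : ℝ, v ∈ Set.Ioc (-R) R → ‖(v : ℂ)‖ ≤ R := fun v hv => by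
    rw [Complex.norm_real, Real.norm_eq_abs]; exact abs_le.2 ⟨hv.1.le, hv.2⟩
  rw [intervalIntegral.integral_const_mul]
  by_cases hw : ‖w‖ ≤ 2 * R
  · -- near case: `‖v - w‖ ≤ 3R` on the interval, singular comparison with `|v - Re w| ^ p`
    have hre : ∀ v : ℝ, |v - w.re| ≤ ‖(v : ℂ) - w‖ := fun v => by
      simpa using Complex.abs_re_le_norm ((v : ℂ) - w)
    have hbound : ∫ v in (-R)..R, g v ≤ ∫ v in (-R)..R, s * ((3 * R) ^ p + |v - w.re| ^ p) := by
      simp only [intervalIntegral.integral_of_le hRle]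
      refine integral_mono_of_nonneg (ae_of_all _ hg0) ?_ ?_
      · have hi : IntervalIntegrable (fun v : ℝ => s * ((3 * R) ^ p + |v - w.re| ^ p))
            volume (-R) R :=
          (intervalIntegrable_const.add
            (intervalIntegrable_abs_sub_rpow hp1 w.re _ _)).const_mul s
        exact (intervalIntegrable_iff_integrableOn_Ioc_of_le hRle).1 hi
      · filter_upwards [ae_restrict_mem measurableSet_Ioc, Measure.ae_ne _ w.re] with v hv hva
        refine (hg v).trans (mul_le_mul_of_nonneg_left ?_ hs)
        have ht3 : ‖(v : ℂ) - w‖ ≤ 3 * R :=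
          calc ‖(v : ℂ) - w‖ ≤ ‖(v : ℂ)‖ + ‖w‖ := norm_sub_le _ _
            _ ≤ R + 2 * R := add_le_add (hnormv v hv) hw
            _ = 3 * R := by ring
        rcases le_or_gt 0 p with hp0 | hp0
        · calc ‖(v : ℂ) - w‖ ^ p ≤ (3 * R) ^ p := Real.rpow_le_rpow (norm_nonneg _) ht3 hp0
            _ ≤ (3 * R) ^ p + |v - w.re| ^ p :=
              le_add_of_nonneg_right (Real.rpow_nonneg (abs_nonneg _) p)
        · calc ‖(v : ℂ) - w‖ ^ p ≤ |v - w.re| ^ p :=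
              Real.rpow_le_rpow_of_nonpos (abs_pos.2 (sub_ne_zero.2 hva)) (hre v) hp0.le
            _ ≤ (3 * R) ^ p + |v - w.re| ^ p := le_add_of_nonneg_left (by positivity)
    have hsplit : ∫ v in (-R)..R, s * ((3 * R) ^ p + |v - w.re| ^ p) =
        s * (2 * R * (3 * R) ^ p + ∫ v in (-R)..R, |v - w.re| ^ p) := by
      rw [intervalIntegral.integral_const_mul,
        intervalIntegral.integral_add intervalIntegrable_const
          (intervalIntegrable_abs_sub_rpow hp1 w.re _ _),
        intervalIntegral.integral_const, smul_eq_mul]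
      ring
    have hwre : |w.re| ≤ 2 * R := (Complex.abs_re_le_norm w).trans hw
    calc ∫ v in (-R)..R, g v
        ≤ s * (2 * R * (3 * R) ^ p + ∫ v in (-R)..R, |v - w.re| ^ p) := hbound.trans_eq hsplit
      _ ≤ s * C := by
          refine mul_le_mul_of_nonneg_left ?_ hs
          exact add_le_add le_rfl (tiltedRankOne_integral_abs_sub_rpow_le hp1 hR hwre)
      _ ≤ s * (C / cR * ∫ v in (-R)..R, ‖(v : ℂ) - w‖ ^ N) := by
          refine mul_le_mul_of_nonneg_left ?_ hs
          rw [div_mul_eq_mul_div, le_div_iff₀ hcR0]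
          exact mul_le_mul_of_nonneg_left hlow hC0
      _ ≤ s * ((R ^ (p - N) + C / cR) * ∫ v in (-R)..R, ‖(v : ℂ) - w‖ ^ N) := by
          refine mul_le_mul_of_nonneg_left (mul_le_mul_of_nonneg_right ?_ hTnn) hs
          exact le_add_of_nonneg_left (Real.rpow_nonneg hR.le _)
      _ = (R ^ (p - N) + C / cR) * (s * ∫ v in (-R)..R, ‖(v : ℂ) - w‖ ^ N) := by ring
  · -- far case: `R ≤ ‖v - w‖` on the interval, so `‖v - w‖ ^ p ≤ R ^ (p - N) * ‖v - w‖ ^ N`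
    rw [not_le] at hw
    have hcont : Continuous fun v : ℝ => ‖(v : ℂ) - w‖ ^ N :=
      ((Complex.continuous_ofReal.sub continuous_const).norm).pow N
    have hbound : ∫ v in (-R)..R, g v ≤
        ∫ v in (-R)..R, s * (R ^ (p - N) * ‖(v : ℂ) - w‖ ^ N) := by
      simp only [intervalIntegral.integral_of_le hRle]
      refine integral_mono_of_nonneg (ae_of_all _ hg0) ?_ ?_
      · have hi : IntervalIntegrable (fun v : ℝ => s * (R ^ (p - N) * ‖(v : ℂ) - w‖ ^ N))
            volume (-R) R :=
          ((hcont.intervalIntegrable _ _).const_mul _).const_mul s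
        exact (intervalIntegrable_iff_integrableOn_Ioc_of_le hRle).1 hi
      · filter_upwards [ae_restrict_mem measurableSet_Ioc] with v hv
        refine (hg v).trans (mul_le_mul_of_nonneg_left ?_ hs)
        have htR : R ≤ ‖(v : ℂ) - w‖ := by
          have h1 := norm_sub_norm_le w (v : ℂ)
          rw [norm_sub_rev] at h1
          linarith [hnormv v hv]
        have ht0 : 0 < ‖(v : ℂ) - w‖ := hR.trans_le htR
        calc ‖(v : ℂ) - w‖ ^ p = ‖(v : ℂ) - w‖ ^ ((N : ℝ) + (p - N)) := by congr 1; ring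
          _ = ‖(v : ℂ) - w‖ ^ N * ‖(v : ℂ) - w‖ ^ (p - N) := by
              rw [Real.rpow_add ht0, Real.rpow_natCast]
          _ ≤ ‖(v : ℂ) - w‖ ^ N * R ^ (p - N) :=
              mul_le_mul_of_nonneg_left (Real.rpow_le_rpow_of_nonpos hR htR hpN) (by positivity)
          _ = R ^ (p - N) * ‖(v : ℂ) - w‖ ^ N := mul_comm _ _
    calc ∫ v in (-R)..R, g v
        ≤ ∫ v in (-R)..R, s * (R ^ (p - N) * ‖(v : ℂ) - w‖ ^ N) := hbound
      _ = s * (R ^ (p - N) * ∫ v in (-R)..R, ‖(v : ℂ) - w‖ ^ N) := by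
          rw [intervalIntegral.integral_const_mul, intervalIntegral.integral_const_mul]
      _ ≤ s * ((R ^ (p - N) + C / cR) * ∫ v in (-R)..R, ‖(v : ℂ) - w‖ ^ N) := by
          refine mul_le_mul_of_nonneg_left (mul_le_mul_of_nonneg_right ?_ hTnn) hs
          exact le_add_of_nonneg_right (div_nonneg hC0 hcR0.le)
      _ = (R ^ (p - N) + C / cR) * (s * ∫ v in (-R)..R, ‖(v : ℂ) - w‖ ^ N) := by ring

/-! ### The registered stub -/

/-- **Registered stub `stub_tiltedRankOneMoment`** (additive, Mathlib-only; the site-disorder analogue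
of the tilted minor-moment core).  For `N ≥ 1`, `0 ≤ ε < N`, `R > 0` there is `K ≥ 0` such that for
every complex square matrix `A` and site `x`,
`∫_{-R}^{R} |det(A + v E_xx)|^N |(A + v E_xx)⁻¹_xx|^{1+ε} dv ≤ K ∫_{-R}^{R} |det(A + v E_xx)|^N dv`:
the `|det|^N`-tilted `(1+ε)`-moment of the diagonal resolvent entry under a uniform single-site
coupling is bounded uniformly in `A` and its size, with the finite-volume threshold `ε < N`.
Mechanism: `det(A + v E_xx) = det A + v c`, `adj(A + v E_xx)_xx = c`, so everything reduces to the
one-variable inequality `∫ ‖v - w‖^{N-1-ε} ≤ K ∫ ‖v - w‖^N` uniformly in `w ∈ ℂ`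
(`tiltedRankOne_oneVariable`). -/
theorem stub_tiltedRankOneMoment :
    ∀ (N : ℕ) (ε R : ℝ), 1 ≤ N → 0 ≤ ε → ε < N → 0 < R →
      ∃ K : ℝ, 0 ≤ K ∧ ∀ (n : ℕ) (A : Matrix (Fin n) (Fin n) ℂ) (x : Fin n),
        ∫ v in (-R)..R, ‖(A + (v : ℂ) • Matrix.single x x (1 : ℂ)).det‖ ^ N * ‖(A + (v : ℂ) • Matrix.single x x (1 : ℂ))⁻¹ x x‖ ^ (1 + ε) ≤ K * ∫ v in (-R)..R, ‖(A + (v : ℂ) • Matrix.single x x (1 : ℂ)).det‖ ^ N := by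
  intro N ε R _hN hε hεN hR
  obtain ⟨K, hK0, hK⟩ := tiltedRankOne_oneVariable N ε R hε hεN hR
  refine ⟨K, hK0, fun n A x => ?_⟩
  have hRle : -R ≤ R := by linarith
  have hε1 : (1 : ℝ) + ε ≠ 0 := by linarith
  set c : ℂ := (A.updateRow x (Pi.single x 1)).det with hc_def
  by_cases hc : c = 0
  · have h0 : ∀ v : ℝ, ‖(A + (v : ℂ) • Matrix.single x x (1 : ℂ)).det‖ ^ N *
        ‖(A + (v : ℂ) • Matrix.single x x (1 : ℂ))⁻¹ x x‖ ^ (1 + ε) = 0 := by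
      intro v
      have h1 : (A + (v : ℂ) • Matrix.single x x (1 : ℂ))⁻¹ x x = 0 := by
        rw [tiltedRankOne_inv_add_smul_single_apply, ← hc_def, hc]; simp
      rw [h1, norm_zero, Real.zero_rpow hε1, mul_zero]
    simp only [h0, intervalIntegral.integral_zero]
    exact mul_nonneg hK0 (intervalIntegral.integral_nonneg hRle fun v _ => by positivity)
  · obtain ⟨w, hw⟩ : ∃ w : ℂ, A.det = -(c * w) := ⟨-A.det / c, by field_simp⟩
    have hD : ∀ v : ℝ, A.det + (v : ℂ) * c = c * ((v : ℂ) - w) := fun v => by rw [hw]; ring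
    have hRHS : ∫ v in (-R)..R, ‖(A + (v : ℂ) • Matrix.single x x (1 : ℂ)).det‖ ^ N =
        ∫ v in (-R)..R, ‖c‖ ^ N * ‖(v : ℂ) - w‖ ^ N :=
      intervalIntegral.integral_congr fun v _ => by
        simp only [tiltedRankOne_det_add_smul_single, ← hc_def, hD, norm_mul, mul_pow]
    rw [hRHS]
    refine hK w (‖c‖ ^ N) (fun v => ‖(A + (v : ℂ) • Matrix.single x x (1 : ℂ)).det‖ ^ N *
      ‖(A + (v : ℂ) • Matrix.single x x (1 : ℂ))⁻¹ x x‖ ^ (1 + ε)) (by positivity)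
      (fun v => by positivity) fun v => ?_
    rw [tiltedRankOne_det_add_smul_single, tiltedRankOne_inv_add_smul_single_apply, ← hc_def, hD]
    rcases eq_or_ne ((v : ℂ) - w) 0 with h0 | h0
    · rw [h0, mul_zero, inv_zero, zero_mul, norm_zero, Real.zero_rpow hε1, mul_zero]
      exact mul_nonneg (pow_nonneg (norm_nonneg _) _) (Real.rpow_nonneg le_rfl _)
    · have ht : 0 < ‖(v : ℂ) - w‖ := norm_pos_iff.2 h0
      have hu : (c * ((v : ℂ) - w))⁻¹ * c = ((v : ℂ) - w)⁻¹ := by field_simp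
      apply le_of_eq
      rw [hu, norm_inv, norm_mul, mul_pow, Real.inv_rpow ht.le, ← Real.rpow_neg ht.le, mul_assoc,
        ← Real.rpow_natCast ‖(v : ℂ) - w‖ N, ← Real.rpow_add ht]
      congr 2
      ring

end Summit.QuantumFields.QCD.Cruxes.PhaseQuenchedFlavourDecay.CrossingSplitIntegrability

end
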